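import Summits.SmoothPoincare4.SmoothPoincare4.Theorems.CongruenceShadowsShadowApproximationStubLayerStepTwoZeroRealisers
import HarnessLib

/-!
# Helper for stub `stub_layerStepBlockZero` (line `nilpotent-genus-class`, crux
`CongruenceShadows.ShadowApproximation`, item stmt-SmoothPoincare4-14595):
# block-embedded genus-`9` matrices at genus `N ≥ 9`, and residue-preserving handle permutations with three prescribed values

`H₁(Σ_N) = ℤ^{Fin N × Bool}`; the first nine handles `Fin.castLE : Fin 9 ↪ Fin N`.  For an integer matrix `M` on
`Fin 9 × Bool` its BLOCK EMBEDDING `E = M ⊕ 1` on `Fin N × Bool` (`E p q = M p q` on the first nine handles, `δ_{pq}`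
beyond, `0` across) is described entrywise by the hypothesis `hE` below (no definition is made; the stub file writes
`E` as a `Matrix.of`).  This file proves, uniformly in `N`:

* §1 sums supported on the first nine handles (`sum_eq_sum_nine`, `sum_eq_sum_nine₂`);
* §2 the entries of `E` against an embedded letter (`blockEmbed_apply_cast_of_lt/ge`, `blockEmbed_cast_apply_of_lt/ge`);
* §3 the decidable Goeritz checks pass from `M` to `E`: two-sided inverses (`blockEmbed_mul`), `Sp`-columns
  (`blockEmbed_symplForm_col`), vanishing Lagrangian blocks (`blockEmbed_block`);
* §4 `exists_perm_three` — for handles `a, b, c` (distinct) and targets `A, B, C` (distinct) with matching residues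
  mod `3` there is a residue-preserving permutation `τ` of `Fin N` (with inverse) with `τ a = A`, `τ b = B`, `τ c = C`
  (three transpositions); `castLE_succ_mod` — `castLE (k + 1) ≡ castLE k + 1`.
No definitions; the registered helper is `helper_permThree`.
-/

set_option linter.dupNamespace false

noncomputable section

open Literature.Topology.FourManifolds

namespace Summit.SmoothPoincare4.SmoothPoincare4.Theorems.ShadowApproximation.NilpotentGenusClass

/-! ## §1 Sums supported on the first nine handles -/

section Sums

variable {N : ℕ} (h9 : 9 ≤ N)

include h9

/-- A sum over `Fin N` of a function supported on the first nine handles is a sum over `Fin 9`. [folklore] -/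
theorem sum_eq_sum_nine (g : Fin N → ℤ) (f : Fin 9 → ℤ)
    (hg : ∀ i : Fin N, g i = if h : (i : ℕ) < 9 then f ⟨i, h⟩ else 0) : ∑ i, g i = ∑ i', f i' := by
  have hsub : ∑ i ∈ (Finset.univ : Finset (Fin 9)).map ⟨Fin.castLE h9, Fin.castLE_injective h9⟩, g i = ∑ i, g i :=
    Finset.sum_subset (Finset.subset_univ _) fun i _ hi => by
      rw [hg, dif_neg]
      intro h
      exact hi (Finset.mem_map.2 ⟨⟨i, h⟩, Finset.mem_univ _, Fin.ext rfl⟩)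
  rw [← hsub, Finset.sum_map]
  refine Finset.sum_congr rfl fun i' _ => ?_
  rw [Function.Embedding.coeFn_mk, hg, dif_pos (show ((Fin.castLE h9 i' : Fin N) : ℕ) < 9 from i'.2)]
  exact congrArg f (Fin.ext rfl)

/-- The same over the letters `Fin N × Bool`. [folklore] -/
theorem sum_eq_sum_nine₂ (g : Fin N × Bool → ℤ) (f : Fin 9 × Bool → ℤ)
    (hg : ∀ r : Fin N × Bool, g r = if h : (r.1 : ℕ) < 9 then f (⟨r.1, h⟩, r.2) else 0) : ∑ r, g r = ∑ r', f r' := by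
  have hinj : Function.Injective (fun r' : Fin 9 × Bool => ((Fin.castLE h9 r'.1 : Fin N), r'.2)) := by
    rintro ⟨i, b⟩ ⟨j, c⟩ h
    simp only [Prod.mk.injEq] at h
    rw [Fin.castLE_injective h9 h.1, h.2]
  have hsub : ∑ r ∈ (Finset.univ : Finset (Fin 9 × Bool)).map ⟨_, hinj⟩, g r = ∑ r, g r :=
    Finset.sum_subset (Finset.subset_univ _) fun r _ hr => by
      rw [hg, dif_neg]
      intro h
      exact hr (Finset.mem_map.2 ⟨(⟨r.1, h⟩, r.2), Finset.mem_univ _, Prod.ext (Fin.ext rfl) rfl⟩)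
  rw [← hsub, Finset.sum_map]
  refine Finset.sum_congr rfl fun r' _ => ?_
  rw [Function.Embedding.coeFn_mk, hg, dif_pos (show ((Fin.castLE h9 r'.1 : Fin N) : ℕ) < 9 from r'.1.2)]
  exact congrArg f (Prod.ext (Fin.ext rfl) rfl)

end Sums

/-! ## §2 Entries of a block-embedded matrix -/

section Entries

variable {N : ℕ} (h9 : 9 ≤ N) {M : Matrix (Fin 9 × Bool) (Fin 9 × Bool) ℤ} {E : Matrix (Fin N × Bool) (Fin N × Bool) ℤ}
  (hE : ∀ p q : Fin N × Bool, E p q = if hp : (p.1 : ℕ) < 9 then (if hq : (q.1 : ℕ) < 9 then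
    M (⟨p.1, hp⟩, p.2) (⟨q.1, hq⟩, q.2) else 0) else (if p = q then 1 else 0))

include hE

/-- Rows in the first nine handles, embedded column. [folklore] -/
theorem blockEmbed_apply_cast_of_lt (x : Fin 9) (β β' : Bool) (h : Fin N) (hh : (h : ℕ) < 9) :
    E (h, β) (Fin.castLE h9 x, β') = M (⟨h, hh⟩, β) (x, β') := by
  rw [hE, dif_pos hh, dif_pos (show ((Fin.castLE h9 x : Fin N) : ℕ) < 9 from x.2)]
  rfl

/-- Rows beyond the first nine handles, embedded column: zero. [folklore] -/
theorem blockEmbed_apply_cast_of_ge (x : Fin 9) (β β' : Bool) (h : Fin N) (hh : 9 ≤ (h : ℕ)) :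
    E (h, β) (Fin.castLE h9 x, β') = 0 := by
  rw [hE, dif_neg (not_lt.2 hh), if_neg]
  intro e
  have := congrArg (fun p : Fin N × Bool => (p.1 : ℕ)) e
  simp only [Fin.val_castLE] at this
  omega

/-- Embedded row, columns in the first nine handles. [folklore] -/
theorem blockEmbed_cast_apply_of_lt (x : Fin 9) (β β' : Bool) (h : Fin N) (hh : (h : ℕ) < 9) :
    E (Fin.castLE h9 x, β') (h, β) = M (x, β') (⟨h, hh⟩, β) := by
  rw [hE, dif_pos (show ((Fin.castLE h9 x : Fin N) : ℕ) < 9 from x.2), dif_pos hh]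
  rfl

/-- Embedded row, columns beyond the first nine handles: zero. [folklore] -/
theorem blockEmbed_cast_apply_of_ge (x : Fin 9) (β β' : Bool) (h : Fin N) (hh : 9 ≤ (h : ℕ)) :
    E (Fin.castLE h9 x, β') (h, β) = 0 := by
  rw [hE, dif_pos (show ((Fin.castLE h9 x : Fin N) : ℕ) < 9 from x.2), dif_neg (not_lt.2 hh)]

/-- Columns beyond the first nine handles are coordinate vectors. [folklore] -/
theorem blockEmbed_col_eq_single (x : Fin N × Bool) (hx : 9 ≤ (x.1 : ℕ)) :
    (fun q => E q x) = Pi.single x (1 : ℤ) := by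
  funext q
  rw [hE, Pi.single_apply]
  by_cases hq : (q.1 : ℕ) < 9
  · rw [dif_pos hq, dif_neg (not_lt.2 hx), if_neg]
    rintro rfl
    omega
  · rw [dif_neg hq]

end Entries

/-! ## §3 The Goeritz checks pass to the block embedding -/

section Checks

variable {N : ℕ} {M M' : Matrix (Fin 9 × Bool) (Fin 9 × Bool) ℤ} {E E' : Matrix (Fin N × Bool) (Fin N × Bool) ℤ}
  (hE : ∀ p q : Fin N × Bool, E p q = if hp : (p.1 : ℕ) < 9 then (if hq : (q.1 : ℕ) < 9 then
    M (⟨p.1, hp⟩, p.2) (⟨q.1, hq⟩, q.2) else 0) else (if p = q then 1 else 0))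
  (hE' : ∀ p q : Fin N × Bool, E' p q = if hp : (p.1 : ℕ) < 9 then (if hq : (q.1 : ℕ) < 9 then
    M' (⟨p.1, hp⟩, p.2) (⟨q.1, hq⟩, q.2) else 0) else (if p = q then 1 else 0))

include hE

include hE' in
/-- **Inverses**: `E E' = 1` from `M M' = 1`. [folklore] -/
theorem blockEmbed_mul (h9 : 9 ≤ N) (h1 : M * M' = 1) : E * E' = 1 := by
  ext p q
  rw [Matrix.mul_apply, Matrix.one_apply]
  by_cases hp : (p.1 : ℕ) < 9
  · by_cases hq : (q.1 : ℕ) < 9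
    · rw [sum_eq_sum_nine₂ h9 _ (fun r' => M (⟨p.1, hp⟩, p.2) r' * M' r' (⟨q.1, hq⟩, q.2)) ?_]
      · rw [← Matrix.mul_apply, h1, Matrix.one_apply]
        by_cases hpq : p = q
        · subst hpq; rw [if_pos rfl, if_pos rfl]
        · rw [if_neg hpq, if_neg]
          intro e
          exact hpq (Prod.ext (Fin.ext (Fin.mk.inj_iff.1 (Prod.mk.inj e).1)) (Prod.mk.inj e).2)
      · intro r
        rw [hE, hE', dif_pos hp]
        by_cases hr : (r.1 : ℕ) < 9
        · rw [dif_pos hr, dif_pos hr, dif_pos hq, dif_pos hr]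
        · rw [dif_neg hr, dif_neg hr, zero_mul, dif_neg hr]
    · rw [Finset.sum_eq_zero, if_neg]
      · rintro rfl; exact hq hp
      · intro r _
        rw [hE']
        by_cases hr : (r.1 : ℕ) < 9
        · rw [dif_pos hr, dif_neg hq, mul_zero]
        · rw [hE, dif_pos hp, dif_neg hr, zero_mul]
  · have hrow : ∀ r, E p r = if p = r then 1 else 0 := fun r => by rw [hE, dif_neg hp]
    simp_rw [hrow, boole_mul, Finset.sum_ite_eq, Finset.mem_univ, if_true]
    rw [hE', dif_neg hp]

omit hE in
/-- `ν(δ_x, δ_y)` only depends on the handle numbers and the letter types. [folklore] -/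
theorem symplForm_single_single_cast (x y : Fin N × Bool) (hx : (x.1 : ℕ) < 9) (hy : (y.1 : ℕ) < 9) :
    symplForm (Pi.single ((⟨x.1, hx⟩ : Fin 9), x.2) (1 : ℤ) : Fin 9 × Bool → ℤ) (Pi.single ((⟨y.1, hy⟩ : Fin 9), y.2) 1) =
      symplForm (Pi.single x (1 : ℤ) : Fin N × Bool → ℤ) (Pi.single y 1) := by
  obtain ⟨i, b⟩ := x
  obtain ⟨j, b'⟩ := y
  cases b <;> cases b' <;>
    simp only [symplForm_single_false_left, symplForm_single_true_left, Pi.single_apply, Prod.mk.injEq,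
      Fin.ext_iff, and_true, and_false, Bool.true_eq_false, Bool.false_eq_true]

/-- **`Sp`-columns**: the columns of `E` pair as the coordinate vectors do, if those of `M` do. [folklore] -/
theorem blockEmbed_symplForm_col (h9 : 9 ≤ N)
    (hS : ∀ x y : Fin 9 × Bool, symplForm (fun q => M q x) (fun q => M q y) =
      symplForm (Pi.single x (1 : ℤ) : Fin 9 × Bool → ℤ) (Pi.single y (1 : ℤ))) :
    ∀ x y : Fin N × Bool, symplForm (fun q => E q x) (fun q => E q y) =
      1 * symplForm (Pi.single x (1 : ℤ) : Fin N × Bool → ℤ) (Pi.single y (1 : ℤ)) := by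
  intro x y
  rw [one_mul]
  by_cases hx : (x.1 : ℕ) < 9
  · by_cases hy : (y.1 : ℕ) < 9
    · rw [← symplForm_single_single_cast x y hx hy, ← hS, symplForm_apply, symplForm_apply]
      refine sum_eq_sum_nine h9 _ _ fun i => ?_
      by_cases hi : (i : ℕ) < 9
      · rw [dif_pos hi]
        simp only [hE, dif_pos hi, dif_pos hx, dif_pos hy]
      · have hxi : ∀ β, ((i, β) : Fin N × Bool) ≠ x := fun β e => hi (by rw [← e] at hx; exact hx)
        have hyi : ∀ β, ((i, β) : Fin N × Bool) ≠ y := fun β e => hi (by rw [← e] at hy; exact hy)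
        rw [dif_neg hi]
        simp only [hE, dif_neg hi, if_neg (hxi _), if_neg (hyi _), zero_mul, sub_self]
    · rw [blockEmbed_col_eq_single hE y (not_lt.1 hy)]
      obtain ⟨j, b'⟩ := y
      have hjx : ∀ β, ((j, β) : Fin N × Bool) ≠ x := fun β e => hy (by rw [← e] at hx; exact hx)
      have hz : ∀ β, E (j, β) x = 0 := fun β => by rw [hE, dif_neg hy, if_neg (hjx β)]
      cases b' <;> simp only [symplForm_single_false_right, symplForm_single_true_right, hz, Pi.single_apply,
        if_neg (hjx _)]
  · rw [blockEmbed_col_eq_single hE x (not_lt.1 hx)]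
    by_cases hy : (y.1 : ℕ) < 9
    · obtain ⟨i, b⟩ := x
      have hiy : ∀ β, ((i, β) : Fin N × Bool) ≠ y := fun β e => hx (by rw [← e] at hy; exact hy)
      have hz : ∀ β, E (i, β) y = 0 := fun β => by rw [hE, dif_neg hx, if_neg (hiy β)]
      cases b <;> simp only [symplForm_single_false_left, symplForm_single_true_left, hz, Pi.single_apply,
        if_neg (hiy _)]
    · rw [blockEmbed_col_eq_single hE y (not_lt.1 hy)]

/-- **Vanishing Lagrangian blocks** pass to the block embedding (the cut patterns only depend on residues). [folklore] -/
theorem blockEmbed_block (r : ℕ)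
    (h0 : ∀ i j : Fin 9, M (i, !decide ((i : ℕ) % 3 = r)) (j, decide ((j : ℕ) % 3 = r)) = 0) :
    ∀ i j : Fin N, E (i, !decide ((i : ℕ) % 3 = r)) (j, decide ((j : ℕ) % 3 = r)) = 0 := by
  intro i j
  rw [hE]
  by_cases hi : (i : ℕ) < 9
  · by_cases hj : (j : ℕ) < 9
    · rw [dif_pos hi, dif_pos hj]; exact h0 ⟨i, hi⟩ ⟨j, hj⟩
    · rw [dif_pos hi, dif_neg hj]
  · rw [dif_neg hi, if_neg]
    intro e
    have e1 : i = j := congrArg Prod.fst e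
    subst e1
    have e2 := congrArg Prod.snd e
    cases h : decide ((i : ℕ) % 3 = r) <;> simp [h] at e2

end Checks

/-! ## §4 Residue-preserving handle permutations with three prescribed values -/

section Perm

variable {N : ℕ}

/-- A transposition of two handles with the same residue preserves residues. [folklore] -/
theorem swap_mod_three (x y : Fin N) (hxy : ((x : Fin N) : ℕ) % 3 = ((y : Fin N) : ℕ) % 3) (h : Fin N) :
    ((Equiv.swap x y h : Fin N) : ℕ) % 3 = ((h : Fin N) : ℕ) % 3 := by
  rcases eq_or_ne h x with rfl | hx
  · rw [Equiv.swap_apply_left]; exact hxy.symm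
  rcases eq_or_ne h y with rfl | hy
  · rw [Equiv.swap_apply_right]; exact hxy
  · rw [Equiv.swap_apply_of_ne_of_ne hx hy]

/-- **Three prescribed values.**  For distinct handles `a, b, c` and distinct targets `A, B, C` with matching residues
mod `3` there is a residue-preserving permutation `τ` of the handles (inverse `σ`) with `τ a = A`, `τ b = B`, `τ c = C`:
`τ = (c₂ C) ∘ (b₁ B) ∘ (a A)` with `b₁ = (a A)(b)`, `c₂ = (b₁ B)((a A)(c))`. [folklore] -/
theorem exists_perm_three (a b c A B C : Fin N) (hab : a ≠ b) (hac : a ≠ c) (hbc : b ≠ c)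
    (hAB : A ≠ B) (hAC : A ≠ C) (hBC : B ≠ C)
    (hA : ((A : Fin N) : ℕ) % 3 = ((a : Fin N) : ℕ) % 3) (hB : ((B : Fin N) : ℕ) % 3 = ((b : Fin N) : ℕ) % 3)
    (hC : ((C : Fin N) : ℕ) % 3 = ((c : Fin N) : ℕ) % 3) :
    ∃ τ σ : Fin N → Fin N, (∀ h, σ (τ h) = h) ∧ (∀ h, τ (σ h) = h) ∧
      (∀ h : Fin N, ((τ h : Fin N) : ℕ) % 3 = ((h : Fin N) : ℕ) % 3) ∧ τ a = A ∧ τ b = B ∧ τ c = C := by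
  classical
  set t₁ : Equiv.Perm (Fin N) := Equiv.swap a A with ht₁
  set t₂ : Equiv.Perm (Fin N) := Equiv.swap (t₁ b) B with ht₂
  set t₃ : Equiv.Perm (Fin N) := Equiv.swap (t₂ (t₁ c)) C with ht₃
  have h1 : ∀ h, ((t₁ h : Fin N) : ℕ) % 3 = (h : ℕ) % 3 := swap_mod_three a A hA.symm
  have h2 : ∀ h, ((t₂ h : Fin N) : ℕ) % 3 = (h : ℕ) % 3 := swap_mod_three _ B ((h1 b).trans hB.symm)
  have h3 : ∀ h, ((t₃ h : Fin N) : ℕ) % 3 = (h : ℕ) % 3 := swap_mod_three _ C (by rw [h2, h1]; exact hC.symm)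
  have ht₁a : t₁ a = A := Equiv.swap_apply_left _ _
  have hb₁A : t₁ b ≠ A := fun h => hab (t₁.injective (ht₁a.trans h.symm))
  have ht₂A : t₂ A = A := Equiv.swap_apply_of_ne_of_ne hb₁A.symm hAB
  have hc₂A : t₂ (t₁ c) ≠ A := fun h =>
    hac (t₁.injective (ht₁a.trans (t₂.injective (ht₂A.trans h.symm))))
  have ht₃A : t₃ A = A := Equiv.swap_apply_of_ne_of_ne hc₂A.symm hAC
  have ht₂b : t₂ (t₁ b) = B := Equiv.swap_apply_left _ _
  have hc₂B : t₂ (t₁ c) ≠ B := fun h => hbc (t₁.injective (t₂.injective (ht₂b.trans h.symm)))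
  have ht₃B : t₃ B = B := Equiv.swap_apply_of_ne_of_ne hc₂B.symm hBC
  refine ⟨fun h => t₃ (t₂ (t₁ h)), fun h => t₁.symm (t₂.symm (t₃.symm h)), fun h => by simp, fun h => by simp,
    fun h => ?_, ?_, ?_, ?_⟩
  · show ((t₃ (t₂ (t₁ h)) : Fin N) : ℕ) % 3 = _
    rw [h3, h2, h1]
  · show t₃ (t₂ (t₁ a)) = A
    rw [ht₁a, ht₂A, ht₃A]
  · show t₃ (t₂ (t₁ b)) = B
    rw [ht₂b, ht₃B]
  · exact Equiv.swap_apply_left _ _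

/-- The embedded successor handle: `castLE (k + 1) ≡ castLE k + 1 (mod N)` for `k + 1 < 9 ≤ N`. [folklore] -/
theorem castLE_succ_mod (h9 : 9 ≤ N) (k : Fin 9) (hk : (k : ℕ) + 1 < 9) :
    ((Fin.castLE h9 (k + 1) : Fin N) : ℕ) = (((Fin.castLE h9 k : Fin N) : ℕ) + 1) % N := by
  rw [Fin.val_castLE, Fin.val_castLE, Fin.val_add, Fin.val_one, Nat.mod_eq_of_lt hk, Nat.mod_eq_of_lt (by omega)]

end Perm

/-! ## Registered helper -/

/-- **Registered helper `helper_permThree`** (sub-goal of stub `stub_layerStepBlockZero`, crux stmt-SmoothPoincare4-14595):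
three prescribed values of a residue-preserving handle permutation. [folklore] -/
theorem helper_permThree : ∀ (N : ℕ) (a b c A B C : Fin N), a ≠ b → a ≠ c → b ≠ c → A ≠ B → A ≠ C → B ≠ C → ((A : Fin N) : ℕ) % 3 = ((a : Fin N) : ℕ) % 3 → ((B : Fin N) : ℕ) % 3 = ((b : Fin N) : ℕ) % 3 → ((C : Fin N) : ℕ) % 3 = ((c : Fin N) : ℕ) % 3 → ∃ τ σ : Fin N → Fin N, (∀ h, σ (τ h) = h) ∧ (∀ h, τ (σ h) = h) ∧ (∀ h : Fin N, ((τ h : Fin N) : ℕ) % 3 = ((h : Fin N) : ℕ) % 3) ∧ τ a = A ∧ τ b = B ∧ τ c = C :=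
  fun _ a b c A B C hab hac hbc hAB hAC hBC hA hB hC => exists_perm_three a b c A B C hab hac hbc hAB hAC hBC hA hB hC

end Summit.SmoothPoincare4.SmoothPoincare4.Theorems.ShadowApproximation.NilpotentGenusClass

end
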